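import Summits.HodgeConjecture.CorCM.GaloisSixteenTableLawsA
import HarnessLib

/-!
# Table models from generators and relations, II: the laws on `ZMod 4 × ZMod 2 × ZMod 2`
# (`D₄ × C₂`, `Q₈ × C₂`, the Pauli group `C₄ ∘ D₄`, and `(C₄ × C₂) ⋊ C₂`)

COR-CM (cell `pub-hodgecm2`), binder seat b04 (gen 17), count-neutral claim GALOIS16-COMPLETE.  KERNEL ONLY:
theorems; no definition, no named fact, no `sorry`.  `HC_CM` is neither used nor claimed.  Pure group theory,
continuing `GaloisSixteenTableLawsA`.

* §1 law C, `(i,j,k) ↦ tᵏ (xⁱ yʲ)` with `y x = x³ y`, `y² = x^b`, `t` central, `t² = x^z`: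
  `(i,j,k)·(i',j',k') = (i + 3^{j} i' + b jj' + z kk', j + j', k + k')` — **`exists_table_lawC`** (`x` of order `4`,
  `y ∉ ⟨x⟩`, `xⁱ yʲ t ≠ 1`, `|G| = 16`) and the instances `exists_table_d4c2` (`b = z = 0`), `exists_table_q8c2`
  (`b = 2, z = 0`), `exists_table_pauli` (`b = 0, z = 2`) for the laws written in `GaloisSixteenPauliCensus`,
  `GaloisSixteenDegenerateTablesB` and the bridges.
* §2 law D, `(i,j,k) ↦ bʲ (aⁱ wᵏ)` with `b` central, `b² = w² = 1`, `w a = a b w` (the group `(C₄ × C₂) ⋊ C₂`):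
  `(i,j,k)·(i',j',k') = (i + i', j + j' + k i', k + k')` — **`exists_table_g3`**.

## References

* [Shimura1998] G. Shimura, *Abelian Varieties with Complex Multiplication and Modular Functions*, §8.1.
* [Dodson1984] B. Dodson, *The structure of Galois groups of CM-fields*, Trans. AMS 283 (1984), §5.3.1.
-/

namespace Summit.HodgeConjecture.CorCM.GaloisTableLaws

variable {G : Type*} [Group G]

/-! ## §1 Law C: `ZMod 4 × ZMod 2 × ZMod 2`, `(i,j,k) ↦ tᵏ (xⁱ yʲ)` -/

section LawC

/-- The `(x, y)`-words multiply by law A modulo `4`: for `x⁴ = 1`, `y x = x^μ y`, `y² = x^τ`,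
`(xⁱ yʲ)(x^{i'} y^{j'}) = x^{i + μʲ i' + τ jj'} y^{j+j'}` with exponents read in `ZMod 4 × ZMod 2`. [folklore] -/
theorem xy_words_mul (x y : G) (μ τ : ZMod 4) (hx4 : x ^ 4 = 1) (hyx : y * x = x ^ μ.val * y)
    (hyy : y * y = x ^ τ.val) (i : ZMod 4) (j : ZMod 2) (i' : ZMod 4) (j' : ZMod 2) :
    (x ^ i.val * y ^ j.val) * (x ^ i'.val * y ^ j'.val) =
      x ^ (i + (if j = 0 then i' else μ * i') + (if j = 1 ∧ j' = 1 then τ else 0)).val * y ^ (j + j').val := by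
  have hv0 : (0 : ZMod 2).val = 0 := rfl
  have hv1 : (1 : ZMod 2).val = 1 := rfl
  have hvμ : (μ * i').val % 4 = μ.val * i'.val % 4 := by rw [ZMod.val_mul]; exact Nat.mod_mod _ _
  obtain ⟨n00, n01, n10, n11⟩ := lawA_nf x y μ.val τ.val hyx hyy i.val i'.val
  rcases zmod2_cases j with rfl | rfl <;> rcases zmod2_cases j' with rfl | rfl
  · rw [if_pos rfl, if_neg (by decide), add_zero, hv0, show ((0 : ZMod 2) + 0).val = 0 from rfl, n00,
      pow_eq_pow_of_mod_eq x hx4 (a := (i + i').val) (b := i.val + i'.val) (by rw [ZMod.val_add]; omega)]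
  · rw [if_pos rfl, if_neg (by decide), add_zero, hv0, hv1, show ((0 : ZMod 2) + 1).val = 1 from rfl, n01,
      pow_eq_pow_of_mod_eq x hx4 (a := (i + i').val) (b := i.val + i'.val) (by rw [ZMod.val_add]; omega)]
  · rw [if_neg (by decide), if_neg (by decide), add_zero, hv0, hv1, show ((1 : ZMod 2) + 0).val = 1 from rfl, n10,
      pow_eq_pow_of_mod_eq x hx4 (a := (i + μ * i').val) (b := i.val + μ.val * i'.val) (by
        rw [ZMod.val_add]; generalize μ.val * i'.val = M at hvμ ⊢; omega)]
  · rw [if_neg (by decide), if_pos ⟨rfl, rfl⟩, hv1, show ((1 : ZMod 2) + 1).val = 0 from rfl, n11,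
      pow_eq_pow_of_mod_eq x hx4 (a := (i + μ * i' + τ).val) (b := i.val + μ.val * i'.val + τ.val) (by
        rw [ZMod.val_add, ZMod.val_add]; generalize μ.val * i'.val = M at hvμ ⊢; omega)]

/-- **Table model for law C.**  `x` of order `4`, `y ∉ ⟨x⟩`, `y x = x³ y`, `y² = x^b`, `t` central with
`t² = x^z` and `xⁱ yʲ t ≠ 1` (`t ∉ ⟨x, y⟩`), `|G| = 16`; `mul` an operation on `ZMod 4 × ZMod 2 × ZMod 2` agreeing
with `(i,j,k)·(i',j',k') = (i + 3ʲ i' + b jj' + z kk', j + j', k + k')`, with right quasi-inverses and cancellation: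
the word map `(i,j,k) ↦ tᵏ xⁱ yʲ` inverts to a table model `e` with `e x = (1,0,0)`, `e y = (0,1,0)`,
`e t = (0,0,1)`, `e 1 = (0,0,0)`. [folklore] -/
theorem exists_table_lawC [Finite G] (x y t : G) (b z : ZMod 4) (hx : orderOf x = 4)
    (hy : y ∉ Subgroup.zpowers x) (ht : ∀ i j : ℕ, x ^ i * y ^ j * t ≠ 1) (hyx : y * x = x ^ 3 * y)
    (hyy : y * y = x ^ b.val) (htx : t * x = x * t) (hty : t * y = y * t) (htt : t * t = x ^ z.val)
    (hcard : Nat.card G = 16)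
    (mul : ZMod 4 × ZMod 2 × ZMod 2 → ZMod 4 × ZMod 2 × ZMod 2 → ZMod 4 × ZMod 2 × ZMod 2)
    (hm : ∀ (i : ZMod 4) (j k : ZMod 2) (i' : ZMod 4) (j' k' : ZMod 2), mul (i, j, k) (i', j', k') =
      (i + (if j = 0 then i' else 3 * i') + (if j = 1 ∧ j' = 1 then b else 0) + (if k = 1 ∧ k' = 1 then z else 0),
        j + j', k + k'))
    (hinv : ∀ q : ZMod 4 × ZMod 2 × ZMod 2, ∃ q', mul q q' = (0, 0, 0))
    (hcancel : ∀ p q q' : ZMod 4 × ZMod 2 × ZMod 2, mul q q' = (0, 0, 0) → mul p q' = (0, 0, 0) → p = q) :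
    ∃ e : G ≃ ZMod 4 × ZMod 2 × ZMod 2, (∀ a c : G, e (a * c) = mul (e a) (e c)) ∧
      e x = (1, 0, 0) ∧ e y = (0, 1, 0) ∧ e t = (0, 0, 1) ∧ e 1 = (0, 0, 0) := by
  have hx4 : x ^ 4 = 1 := by rw [← hx]; exact pow_orderOf_eq_one x
  have hv0 : (0 : ZMod 2).val = 0 := rfl
  have hv1 : (1 : ZMod 2).val = 1 := rfl
  have h3 : (3 : ZMod 4).val = 3 := rfl
  -- `t` commutes with the `(x, y)`-words
  have hcomm : ∀ (n i j : ℕ), Commute (t ^ n) (x ^ i * y ^ j) := fun n i j =>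
    Commute.pow_left (Commute.mul_right (Commute.pow_right htx i) (Commute.pow_right hty j)) n
  -- the `(x, y)`-part
  have hxy := xy_words_mul x y 3 b hx4 (by rw [h3]; exact hyx) hyy
  set f : ZMod 4 × ZMod 2 × ZMod 2 → G := fun p => t ^ p.2.2.val * (x ^ p.1.val * y ^ p.2.1.val) with hf_def
  have hshift : ∀ (E : ZMod 4) (c : ZMod 2), x ^ z.val * (x ^ E.val * y ^ c.val) = x ^ (E + z).val * y ^ c.val := by
    intro E c
    rw [← mul_assoc, ← pow_add, pow_eq_pow_of_mod_eq x hx4 (a := z.val + E.val) (b := (E + z).val)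
      (by rw [ZMod.val_add]; omega)]
  have hf : ∀ p q, f (mul p q) = f p * f q := by
    rintro ⟨i, j, k⟩ ⟨i', j', k'⟩
    rw [hm]
    simp only [hf_def]
    -- move `t^{k'}` to the front on the right
    rw [show t ^ k.val * (x ^ i.val * y ^ j.val) * (t ^ k'.val * (x ^ i'.val * y ^ j'.val)) =
        (t ^ k.val * t ^ k'.val) * ((x ^ i.val * y ^ j.val) * (x ^ i'.val * y ^ j'.val)) by
      rw [mul_assoc, ← mul_assoc (x ^ i.val * y ^ j.val), ← (hcomm k'.val i.val j.val).eq]; simp only [mul_assoc],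
      hxy i j i' j']
    have h00 : (0 : ZMod 2) + 0 = 0 := by decide
    have h01 : (0 : ZMod 2) + 1 = 1 := by decide
    have h10 : (1 : ZMod 2) + 0 = 1 := by decide
    have h11 : (1 : ZMod 2) + 1 = 0 := by decide
    rcases zmod2_cases k with rfl | rfl <;> rcases zmod2_cases k' with rfl | rfl
    · rw [h00, if_neg (show ¬ ((0 : ZMod 2) = 1 ∧ (0 : ZMod 2) = 1) by decide), add_zero]
      simp only [hv0, pow_zero, one_mul]
    · rw [h01, if_neg (show ¬ ((0 : ZMod 2) = 1 ∧ (1 : ZMod 2) = 1) by decide), add_zero]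
      simp only [hv0, hv1, pow_zero, pow_one, one_mul]
    · rw [h10, if_neg (show ¬ ((1 : ZMod 2) = 1 ∧ (0 : ZMod 2) = 1) by decide), add_zero]
      simp only [hv0, hv1, pow_zero, pow_one, mul_one]
    · rw [h11, if_pos (show (1 : ZMod 2) = 1 ∧ (1 : ZMod 2) = 1 from ⟨rfl, rfl⟩)]
      simp only [hv0, hv1, pow_zero, pow_one, one_mul]
      rw [htt, hshift]
  have hker : ∀ p, f p = 1 → p = (0, 0, 0) := by
    rintro ⟨i, j, k⟩ h
    simp only [hf_def] at h
    rcases zmod2_cases k with rfl | rfl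
    · rw [hv0, pow_zero, one_mul] at h
      rcases zmod2_cases j with rfl | rfl
      · rw [hv0, pow_zero, mul_one] at h
        have hdvd : orderOf x ∣ i.val := orderOf_dvd_of_pow_eq_one h
        rw [hx] at hdvd
        have hi : i.val = 0 := by have := ZMod.val_lt i; omega
        rw [ZMod.val_eq_zero] at hi
        rw [hi]
      · exfalso
        rw [hv1, pow_one, mul_eq_one_iff_eq_inv] at h
        have h' : y = (x ^ i.val)⁻¹ := by rw [← inv_inj, ← h, inv_inv]
        exact hy (h' ▸ Subgroup.inv_mem _ (Subgroup.pow_mem _ (Subgroup.mem_zpowers x) _))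
    · exfalso
      rw [hv1, pow_one, (Commute.mul_right (Commute.pow_right htx i.val) (Commute.pow_right hty j.val)).eq] at h
      exact ht i.val j.val h
  obtain ⟨e, he, hef⟩ := exists_table_equiv_of_words mul (0, 0, 0) f hf hker hinv hcancel
    (by rw [hcard]; simp [ZMod.card])
  refine ⟨e, he, ?_, ?_, ?_, ?_⟩
  · have h := hef (1, 0, 0)
    simp only [hf_def, hv0, pow_zero, mul_one, one_mul] at h
    rwa [show (1 : ZMod 4).val = 1 from rfl, pow_one] at h
  · have h := hef (0, 1, 0)
    simp only [hf_def, hv0, hv1, pow_zero, pow_one, one_mul, ZMod.val_zero] at h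
    exact h
  · have h := hef (0, 0, 1)
    simp only [hf_def, hv0, hv1, pow_zero, pow_one, mul_one, ZMod.val_zero] at h
    exact h
  · have h := hef (0, 0, 0)
    simp only [hf_def, hv0, pow_zero, mul_one, ZMod.val_zero] at h
    exact h

/-- **`D₄ × C₂`-type generators** (`y² = 1`, `t² = 1`): a table model for the law of
`GaloisSixteenDegenerateTablesB` (`exists_simple_degenerate_d4c2t`) and of the `D₄ × C₂` bridge. [folklore] -/
theorem exists_table_d4c2 [Finite G] (x y t : G) (hx : orderOf x = 4) (hy : y ∉ Subgroup.zpowers x)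
    (ht : ∀ i j : ℕ, x ^ i * y ^ j * t ≠ 1) (hyx : y * x = x ^ 3 * y) (hyy : y * y = 1) (htx : t * x = x * t)
    (hty : t * y = y * t) (htt : t * t = 1) (hcard : Nat.card G = 16) :
    ∃ e : G ≃ ZMod 4 × ZMod 2 × ZMod 2, (∀ a c : G, e (a * c) =
      (fun p q : ZMod 4 × ZMod 2 × ZMod 2 => (p.1 + (if p.2.1 = 0 then q.1 else 3 * q.1), p.2.1 + q.2.1,
        p.2.2 + q.2.2)) (e a) (e c)) ∧
      e x = (1, 0, 0) ∧ e y = (0, 1, 0) ∧ e t = (0, 0, 1) ∧ e 1 = (0, 0, 0) :=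
  exists_table_lawC x y t 0 0 hx hy ht hyx (by simpa using hyy) htx hty (by simpa using htt) hcard
    (fun p q : ZMod 4 × ZMod 2 × ZMod 2 => (p.1 + (if p.2.1 = 0 then q.1 else 3 * q.1), p.2.1 + q.2.1,
      p.2.2 + q.2.2)) (by decide) (by decide) (by decide)

/-- **`Q₈ × C₂`-type generators** (`y² = x²`, `t² = 1`): a table model for the law of
`GaloisSixteenDegenerateTablesB` (`exists_simple_degenerate_q8c2t`) and of the `Q₈ × C₂` bridge. [folklore] -/
theorem exists_table_q8c2 [Finite G] (x y t : G) (hx : orderOf x = 4) (hy : y ∉ Subgroup.zpowers x)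
    (ht : ∀ i j : ℕ, x ^ i * y ^ j * t ≠ 1) (hyx : y * x = x ^ 3 * y) (hyy : y * y = x ^ 2) (htx : t * x = x * t)
    (hty : t * y = y * t) (htt : t * t = 1) (hcard : Nat.card G = 16) :
    ∃ e : G ≃ ZMod 4 × ZMod 2 × ZMod 2, (∀ a c : G, e (a * c) =
      (fun p q : ZMod 4 × ZMod 2 × ZMod 2 => (p.1 + (if p.2.1 = 0 then q.1 else 3 * q.1) +
        (if p.2.1 = 1 ∧ q.2.1 = 1 then 2 else 0), p.2.1 + q.2.1, p.2.2 + q.2.2)) (e a) (e c)) ∧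
      e x = (1, 0, 0) ∧ e y = (0, 1, 0) ∧ e t = (0, 0, 1) ∧ e 1 = (0, 0, 0) :=
  exists_table_lawC x y t 2 0 hx hy ht hyx hyy htx hty (by simpa using htt) hcard
    (fun p q : ZMod 4 × ZMod 2 × ZMod 2 => (p.1 + (if p.2.1 = 0 then q.1 else 3 * q.1) +
      (if p.2.1 = 1 ∧ q.2.1 = 1 then 2 else 0), p.2.1 + q.2.1, p.2.2 + q.2.2)) (by decide) (by decide) (by decide)

/-- **Pauli-type generators** (`y² = 1`, `t` central of order `4` with `t² = x²`): a table model for the law of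
`GaloisSixteenPauliCensus` (`isNondegenerate_pauli`). [folklore] -/
theorem exists_table_pauli [Finite G] (x y t : G) (hx : orderOf x = 4) (hy : y ∉ Subgroup.zpowers x)
    (ht : ∀ i j : ℕ, x ^ i * y ^ j * t ≠ 1) (hyx : y * x = x ^ 3 * y) (hyy : y * y = 1) (htx : t * x = x * t)
    (hty : t * y = y * t) (htt : t * t = x ^ 2) (hcard : Nat.card G = 16) :
    ∃ e : G ≃ ZMod 4 × ZMod 2 × ZMod 2, (∀ a c : G, e (a * c) =
      (fun p q : ZMod 4 × ZMod 2 × ZMod 2 => (p.1 + (if p.2.1 = 0 then q.1 else 3 * q.1) +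
        (if p.2.2 = 1 ∧ q.2.2 = 1 then 2 else 0), p.2.1 + q.2.1, p.2.2 + q.2.2)) (e a) (e c)) ∧
      e x = (1, 0, 0) ∧ e y = (0, 1, 0) ∧ e t = (0, 0, 1) ∧ e 1 = (0, 0, 0) :=
  exists_table_lawC x y t 0 2 hx hy ht hyx (by simpa using hyy) htx hty htt hcard
    (fun p q : ZMod 4 × ZMod 2 × ZMod 2 => (p.1 + (if p.2.1 = 0 then q.1 else 3 * q.1) +
      (if p.2.2 = 1 ∧ q.2.2 = 1 then 2 else 0), p.2.1 + q.2.1, p.2.2 + q.2.2)) (by decide) (by decide) (by decide)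

end LawC

/-! ## §2 Law D: `ZMod 4 × ZMod 2 × ZMod 2`, `(i,j,k) ↦ bʲ (aⁱ wᵏ)` (the group `(C₄ × C₂) ⋊ C₂`) -/

section LawD

/-- `w aᵐ = aᵐ bᵐ w` from `w a = a b w` with `b` central. [folklore] -/
theorem w_mul_pow (a b w : G) (hba : b * a = a * b) (hwa : w * a = a * b * w) (m : ℕ) :
    w * a ^ m = a ^ m * b ^ m * w := by
  induction m with
  | zero => simp
  | succ m ih =>
    have hbma : Commute (b ^ m) a := Commute.pow_left hba m
    rw [pow_succ, ← mul_assoc, ih, mul_assoc, hwa, ← mul_assoc, ← mul_assoc, mul_assoc (a ^ m), hbma.eq,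
      ← mul_assoc, ← pow_succ, mul_assoc (a ^ (m + 1)), ← pow_succ]

/-- Parity of an element of `ZMod 4`. [folklore] -/
theorem zmod4_parity : ∀ i : ZMod 4, ((i = 1 ∨ i = 3) ∧ i.val % 2 = 1) ∨ (¬ (i = 1 ∨ i = 3) ∧ i.val % 2 = 0) := by
  decide

/-- **Table model for law D** (`(C₄ × C₂) ⋊ C₂ = ⟨a, b, w | a⁴ = b² = w² = 1, b central, w a w = ab⟩`).  `a` of
order `4`, `b ∉ ⟨a⟩`, `aⁱ bʲ w ≠ 1`, `|G| = 16`: the word map `(i,j,k) ↦ bʲ aⁱ wᵏ` inverts to a table model for the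
law of `GaloisSixteenDegenerateTablesB` (`exists_simple_degenerate_g3b/g3a`), with `e a = (1,0,0)`,
`e b = (0,1,0)`, `e w = (0,0,1)`, `e 1 = (0,0,0)`. [folklore] -/
theorem exists_table_g3 [Finite G] (a b w : G) (ha : orderOf a = 4) (hb : b ∉ Subgroup.zpowers a)
    (hw : ∀ i j : ℕ, a ^ i * b ^ j * w ≠ 1) (hba : b * a = a * b) (hbb : b * b = 1) (hbw : b * w = w * b)
    (hww : w * w = 1) (hwa : w * a = a * b * w) (hcard : Nat.card G = 16) :
    ∃ e : G ≃ ZMod 4 × ZMod 2 × ZMod 2, (∀ g h : G, e (g * h) =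
      (fun p q : ZMod 4 × ZMod 2 × ZMod 2 => (p.1 + q.1, p.2.1 + q.2.1 +
        (if p.2.2 = 1 ∧ (q.1 = 1 ∨ q.1 = 3) then 1 else 0), p.2.2 + q.2.2)) (e g) (e h)) ∧
      e a = (1, 0, 0) ∧ e b = (0, 1, 0) ∧ e w = (0, 0, 1) ∧ e 1 = (0, 0, 0) := by
  have ha4 : a ^ 4 = 1 := by rw [← ha]; exact pow_orderOf_eq_one a
  have hb2 : b ^ 2 = 1 := by rw [pow_two, hbb]
  have hw2 : w ^ 2 = 1 := by rw [pow_two, hww]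
  have hv0 : (0 : ZMod 2).val = 0 := rfl
  have hv1 : (1 : ZMod 2).val = 1 := rfl
  set mul : ZMod 4 × ZMod 2 × ZMod 2 → ZMod 4 × ZMod 2 × ZMod 2 → ZMod 4 × ZMod 2 × ZMod 2 :=
    fun p q => (p.1 + q.1, p.2.1 + q.2.1 + (if p.2.2 = 1 ∧ (q.1 = 1 ∨ q.1 = 3) then 1 else 0), p.2.2 + q.2.2)
    with hmul_def
  -- `b` powers are central
  have hbc : ∀ (n i k : ℕ), Commute (b ^ n) (a ^ i * w ^ k) := fun n i k =>
    Commute.pow_left (Commute.mul_right (Commute.pow_right hba i) (Commute.pow_right hbw k)) n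
  set f : ZMod 4 × ZMod 2 × ZMod 2 → G := fun p => b ^ p.2.1.val * (a ^ p.1.val * w ^ p.2.2.val) with hf_def
  -- the `(a, w)`-part: `(aⁱ wᵏ)(a^{i'} w^{k'}) = b^{k i'} a^{i+i'} w^{k+k'}`
  have haw : ∀ (i : ZMod 4) (k : ZMod 2) (i' : ZMod 4) (k' : ZMod 2),
      (a ^ i.val * w ^ k.val) * (a ^ i'.val * w ^ k'.val) =
        b ^ (k.val * i'.val) * (a ^ (i + i').val * w ^ (k + k').val) := by
    intro i k i' k'
    have hii : a ^ (i.val + i'.val) = a ^ (i + i').val :=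
      pow_eq_pow_of_mod_eq a ha4 (by rw [ZMod.val_add]; omega)
    rcases zmod2_cases k with rfl | rfl
    · rw [hv0, pow_zero, mul_one, zero_mul, pow_zero, one_mul, zero_add, ← mul_assoc, ← pow_add, hii]
    · have hk' : (k'.val + 1) % 2 = ((1 : ZMod 2) + k').val % 2 := by
        rcases zmod2_cases k' with rfl | rfl <;> decide
      rw [hv1, pow_one, one_mul]
      calc a ^ i.val * w * (a ^ i'.val * w ^ k'.val)
          = a ^ i.val * (w * a ^ i'.val) * w ^ k'.val := by simp only [mul_assoc]
        _ = a ^ i.val * (a ^ i'.val * b ^ i'.val * w) * w ^ k'.val := by rw [w_mul_pow a b w hba hwa]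
        _ = a ^ (i.val + i'.val) * b ^ i'.val * (w * w ^ k'.val) := by simp only [mul_assoc, pow_add]
        _ = b ^ i'.val * (a ^ (i + i').val * w ^ ((1 : ZMod 2) + k').val) := by
          rw [← (Commute.pow_pow hba i'.val (i.val + i'.val)).eq, hii, ← pow_succ',
            pow_eq_pow_of_mod_eq w hw2 hk', mul_assoc]
  have hf : ∀ p q, f (mul p q) = f p * f q := by
    rintro ⟨i, j, k⟩ ⟨i', j', k'⟩
    simp only [hf_def, hmul_def]
    -- RHS: pull `b^{j'}` to the front, then the `(a,w)`-part
    rw [show b ^ j.val * (a ^ i.val * w ^ k.val) * (b ^ j'.val * (a ^ i'.val * w ^ k'.val)) =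
        (b ^ j.val * b ^ j'.val) * ((a ^ i.val * w ^ k.val) * (a ^ i'.val * w ^ k'.val)) by
      rw [mul_assoc, ← mul_assoc (a ^ i.val * w ^ k.val), ← (hbc j'.val i.val k.val).eq]; simp only [mul_assoc],
      haw i k i' k', ← mul_assoc (b ^ j.val * b ^ j'.val), ← pow_add, ← pow_add]
    congr 1
    refine pow_eq_pow_of_mod_eq b hb2 ?_
    rw [ZMod.val_add, ZMod.val_add]
    rcases zmod2_cases k with rfl | rfl
    · rw [if_neg (fun h => absurd h.1 (by decide)), ZMod.val_zero]; omega
    · rcases zmod4_parity i' with ⟨hi', hpar⟩ | ⟨hi', hpar⟩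
      · rw [if_pos ⟨rfl, hi'⟩, hv1]; omega
      · rw [if_neg (fun h => hi' h.2), ZMod.val_zero, hv1]; omega
  have hker : ∀ p, f p = 1 → p = (0, 0, 0) := by
    rintro ⟨i, j, k⟩ h
    simp only [hf_def] at h
    rw [(hbc j.val i.val k.val).eq, mul_assoc, (Commute.pow_pow hbw j.val k.val).symm.eq, ← mul_assoc] at h
    rcases zmod2_cases k with rfl | rfl
    · rw [hv0, pow_zero, mul_one] at h
      rcases zmod2_cases j with rfl | rfl
      · rw [hv0, pow_zero, mul_one] at h
        have hdvd : orderOf a ∣ i.val := orderOf_dvd_of_pow_eq_one h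
        rw [ha] at hdvd
        have hi : i.val = 0 := by have := ZMod.val_lt i; omega
        rw [ZMod.val_eq_zero] at hi
        rw [hi]
      · exfalso
        rw [hv1, pow_one, mul_eq_one_iff_eq_inv] at h
        have h' : b = (a ^ i.val)⁻¹ := by rw [← inv_inj, ← h, inv_inv]
        exact hb (h' ▸ Subgroup.inv_mem _ (Subgroup.pow_mem _ (Subgroup.mem_zpowers a) _))
    · exact absurd (by rwa [hv1, pow_one] at h) (hw i.val j.val)
  obtain ⟨e, he, hef⟩ := exists_table_equiv_of_words mul (0, 0, 0) f hf hker (by decide) (by decide)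
    (by rw [hcard]; simp [ZMod.card])
  refine ⟨e, he, ?_, ?_, ?_, ?_⟩
  · have h := hef (1, 0, 0)
    simp only [hf_def, hv0, pow_zero, mul_one, one_mul] at h
    rwa [show (1 : ZMod 4).val = 1 from rfl, pow_one] at h
  · have h := hef (0, 1, 0)
    simp only [hf_def, hv0, hv1, pow_zero, pow_one, mul_one, ZMod.val_zero] at h
    exact h
  · have h := hef (0, 0, 1)
    simp only [hf_def, hv0, hv1, pow_zero, pow_one, one_mul, ZMod.val_zero] at h
    exact h
  · have h := hef (0, 0, 0)
    simp only [hf_def, hv0, pow_zero, mul_one, ZMod.val_zero] at h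
    exact h

end LawD

end Summit.HodgeConjecture.CorCM.GaloisTableLaws
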